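import Mathlib
import HarnessLib
import Summits.CriticalPhenomena.SAWScalingLimit.Theses.SAWTrackTransport
import Literature.Probability.RandomPlanarGeometry.LatticeSimilarityCovariance

/-!
# `HexTransfer`, line yb-relay — reduction of stub `stub_angleTransport`

The open stub `stub_angleTransport` of line yb-relay (asymptotic equality, on bounded continuous test
functions, of the critical Glazman–Manolescu Yang–Baxter SAW laws at the constant angles `π/3` and
`π/2` in every Dobrushin domain) follows from two items of route SAWTrackTransport:
`YBLimitExists` (stmt-CriticalPhenomena-16995: a robust full chordal limit `P` of the square-tiling
walk exists) and `AngleUniversality` (stmt-CriticalPhenomena-16963: a robust full square limit is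
the robust full limit at every angle `α ∈ [π/3, 2π/3]`). Both laws then converge to `P D` on every
test function (robust limits specialised to the unshifted domain, `u ≡ 0`), so their difference
tends to `0`.
-/

namespace Summit.CriticalPhenomena.SAWScalingLimit.Cruxes.HexTransfer.YbRelay

open MeasureTheory Filter Topology Set
open Literature.Probability.RandomPlanarGeometry
open Literature.Probability.RandomPlanarGeometry.SAW.YangBaxter
open Summit.CriticalPhenomena.SAWScalingLimit.Theses

/-- The translate of a marked domain by `0` (the similarity `z ↦ 1 · z + 0`) has the same carrier. -/
theorem carrier_map_similarity_one_zero (D : DobrushinDomain) :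
    (D.map (similarity 1 one_ne_zero 0)).carrier = D.carrier := by
  ext z; simp [MarkedDomain.carrier_map]

/-- The zero shift `u ≡ 0` is an admissible family of sub-mesh translates: `‖0‖ ≤ δ` for `δ > 0`. -/
theorem eventually_norm_zero_le :
    ∀ᶠ δ in 𝓝[>] (0 : ℝ), ‖(fun _ : ℝ => (0 : ℂ)) δ‖ ≤ δ := by
  filter_upwards [self_mem_nhdsWithin] with δ hδ
  simpa using le_of_lt hδ

/-- **Robust limit ⇒ plain limit.** If `P` is the robust full limit `RL(α) P` of the critical
Yang–Baxter walk at constant angle `α` (route SAWTrackTransport's local predicate, written out),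
then for every Dobrushin domain `D` and every endpoint approximation `(a, b)` of `D` at angle `α`
the law `ybLaw α D δ 1 (a δ) (b δ)`, pushed to curves, converges in law to `P D`: specialise the
robust limit to the zero shift `u ≡ 0` and transport along the carrier equality
`(D.map (similarity 1 _ 0)).carrier = D.carrier`. -/
theorem tendstoLaw_of_robustLimit (α : ℝ) (P : ChordalFamily)
    (hRL : ∀ (D : DobrushinDomain) (u : ℝ → ℂ) (a b : ℝ → MidEdge),
      (∀ᶠ δ in 𝓝[>] (0 : ℝ), ‖u δ‖ ≤ δ) →
      (∀ᶠ δ in 𝓝[>] (0 : ℝ), Nonempty (YangBaxterSAW (fun (_ : ℤ) => α)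
        ((D.map (similarity 1 one_ne_zero (u δ))).carrier) δ (a δ) (b δ))) →
      Tendsto (fun δ : ℝ => (δ : ℂ) * planeMidpoint (fun (_ : ℤ) => α) (a δ)) (𝓝[>] (0 : ℝ))
        (𝓝 (D.pt 0)) →
      Tendsto (fun δ : ℝ => (δ : ℂ) * planeMidpoint (fun (_ : ℤ) => α) (b δ)) (𝓝[>] (0 : ℝ))
        (𝓝 (D.pt 1)) →
      TendstoLaw (fun δ (γ : YangBaxterSAW (fun (_ : ℤ) => α)
          ((D.map (similarity 1 one_ne_zero (u δ))).carrier) δ (a δ) (b δ)) =>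
          γ.curve (fun (_ : ℤ) => α) δ)
        (fun δ => ybLaw (fun (_ : ℤ) => α) ((D.map (similarity 1 one_ne_zero (u δ))).carrier) δ 1
          (a δ) (b δ)) id (P D))
    (D : DobrushinDomain) (a b : ℝ → MidEdge) (hab : IsYBEndpointApprox (fun (_ : ℤ) => α) D a b) :
    TendstoLaw (fun δ (γ : YangBaxterSAW (fun (_ : ℤ) => α) D.carrier δ (a δ) (b δ)) =>
        γ.curve (fun (_ : ℤ) => α) δ)
      (fun δ => ybLaw (fun (_ : ℤ) => α) D.carrier δ 1 (a δ) (b δ)) id (P D) := by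
  have h0 := hRL D (fun _ : ℝ => (0 : ℂ)) a b eventually_norm_zero_le
  -- transport along the (propositional) equality of carriers
  have key : ∀ T : Set ℂ, T = D.carrier →
      ((∀ᶠ δ in 𝓝[>] (0 : ℝ), Nonempty (YangBaxterSAW (fun (_ : ℤ) => α) T δ (a δ) (b δ))) →
        Tendsto (fun δ : ℝ => (δ : ℂ) * planeMidpoint (fun (_ : ℤ) => α) (a δ)) (𝓝[>] (0 : ℝ))
          (𝓝 (D.pt 0)) →
        Tendsto (fun δ : ℝ => (δ : ℂ) * planeMidpoint (fun (_ : ℤ) => α) (b δ)) (𝓝[>] (0 : ℝ))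
          (𝓝 (D.pt 1)) →
        TendstoLaw (fun δ (γ : YangBaxterSAW (fun (_ : ℤ) => α) T δ (a δ) (b δ)) =>
            γ.curve (fun (_ : ℤ) => α) δ)
          (fun δ => ybLaw (fun (_ : ℤ) => α) T δ 1 (a δ) (b δ)) id (P D)) →
      TendstoLaw (fun δ (γ : YangBaxterSAW (fun (_ : ℤ) => α) D.carrier δ (a δ) (b δ)) =>
          γ.curve (fun (_ : ℤ) => α) δ)
        (fun δ => ybLaw (fun (_ : ℤ) => α) D.carrier δ 1 (a δ) (b δ)) id (P D) := by
    intro T hT h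
    subst hT
    exact h hab.nonempty hab.tendsto_fst hab.tendsto_snd
  exact key _ (carrier_map_similarity_one_zero D) h0

/-- **Reduction of stub `stub_angleTransport` (line yb-relay of crux `HexTransfer`) to route
SAWTrackTransport.** `YBLimitExists` (stmt-CriticalPhenomena-16995) and `AngleUniversality`
(stmt-CriticalPhenomena-16963) imply the law-level Yang–Baxter transport `π/3 ↔ π/2`: for every
Dobrushin domain `D`, every `π/3` endpoint approximation `(a, b)` and every `π/2` endpoint
approximation `(a', b')` of `D`, and every bounded continuous `f` on `CurveClass ℂ`, the difference
`∫ f ∘ curve d ybLaw(π/3)(D)_δ − ∫ f ∘ curve d ybLaw(π/2)(D)_δ` tends to `0` as `δ → 0⁺`. Proof: take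
the robust full square limit `P` of `YBLimitExists`; `AngleUniversality` at `α = π/3 ∈ [π/3, 2π/3]`
makes it the robust full limit at angle `π/3` as well; both robust limits, specialised to the zero
shift (`tendstoLaw_of_robustLimit`), send the two integrals to `∫ f d(P D)`; subtract. -/
theorem angleTransport_of_trackTransport : SAWTrackTransport.YBLimitExists → SAWTrackTransport.AngleUniversality → ∀ (D : DobrushinDomain) (a b a' b' : ℝ → MidEdge), IsYBEndpointApprox (fun (_ : ℤ) => Real.pi / 3) D a b → IsYBEndpointApprox (fun (_ : ℤ) => Real.pi / 2) D a' b' → ∀ f : BoundedContinuousFunction (CurveClass ℂ) ℝ, Tendsto (fun δ : ℝ => (∫ γ, f (γ.curve (fun (_ : ℤ) => Real.pi / 3) δ) ∂(ybLaw (fun (_ : ℤ) => Real.pi / 3) D.carrier δ 1 (a δ) (b δ))) - ∫ γ, f (γ.curve (fun (_ : ℤ) => Real.pi / 2) δ) ∂(ybLaw (fun (_ : ℤ) => Real.pi / 2) D.carrier δ 1 (a' δ) (b' δ))) (𝓝[>] (0 : ℝ)) (𝓝 0) := by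
  intro hL hAU D a b a' b' hab hab' f
  -- the robust full limit `P` of the square-tiling walk
  obtain ⟨-, P, hPch, hconv2⟩ := hL
  -- `π/3` lies in Glazman–Manolescu's range `[π/3, 2π/3]`
  have hmem : Real.pi / 3 ∈ Set.Icc (Real.pi / 3) (2 * Real.pi / 3) :=
    ⟨le_rfl, by linarith [Real.pi_pos]⟩
  -- angle universality: `P` is also the robust full limit at angle `π/3`
  have hconv3 := hAU (Real.pi / 3) hmem P hPch hconv2
  -- both laws converge to `P D` on the test function `f`
  have h3 := tendstoLaw_of_robustLimit (Real.pi / 3) P hconv3 D a b hab f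
  have h2 := tendstoLaw_of_robustLimit (Real.pi / 2) P hconv2 D a' b' hab' f
  have hsub := h3.sub h2
  rwa [sub_self] at hsub

end Summit.CriticalPhenomena.SAWScalingLimit.Cruxes.HexTransfer.YbRelay
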